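import Summits.Ventures.HSemireg.Mod4SiteRowsModel
import Summits.Ventures.HSemireg.Mod4SiteUBlock
import Summits.Ventures.HSemireg.Mod4SiteTags
import Summits.Ventures.HSemireg.WedgeWeilPurityLocus

/-!
# Venture HSemireg — MOD-4 line: the coupled block `U` of THEOREM R_f's middle degree IN th-7's WEIL MODEL, part 1
# (selection words = unit multiples of basis monomials; block monomials = pair products; the rows `μ_B ∧ v`, `μ′_{B′} ∧ v`)

HONEST FRAMING. Part of the Lean index of the computation cell `pub-hsemireg` (widening group W3, seat w3-mod4-1 gen 5; files
of record `HOME/widen/W3/MOD4-OFFSPLIT-w3mod4.md` §10.2 / §11, `MOD4-THEOREM-RF-PROOF-w3mod4.md` v1.0 §4).  Finite-dimensional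
exterior algebra over a field ONLY (th-7's sign-free transposed wedge model): no abelian variety, no sheaf, no Ext group, no
semiregularity map; nothing here says that HC, HC_CM or HC_AV holds; no Literature fact is declared or used; THEOREM R_f is NOT
asserted here.  WHAT IS PROVED (type `(n,n)`, `v = Wedge.Weil.vW K (n+n) n q a b`; letters `x_k = b(xJ (castAdd n k))` etc. as in
`Mod4SiteRowsModel.lean`; `μ_B`, `μ′_{B′}` the selection words of the two blocks, `m_P`, `m_Q` the pair products):
* §1 `prod_ι_b_eq_smul_B` — an ordered product of generators at distinct indices is a NON-ZERO multiple of the basis monomial of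
  its index set (so the selection words are `±E_t` up to th-7's unit structure constants);
* §2 `pp_eq_prod_ofFn`, `B_Dm_eq_smul_pairProd`, `B_Gm_eq_smul_pairProd` — th-7's block monomials are `(−1)^{C(n,2)}` times the
  pair products `m_P`, `m_Q` (th-7's `B_Dm_eq`/`B_Gm_eq` in `List.ofFn` form);
* §3 `wordP_mul_vW`, `wordQ_mul_vW` — the ROWS: `μ_B ∧ v = (a r)·g_B + Σ_{B′} κ(−1)^{|B′|}q̃_{n−|B|+|B′|}·f_{B′}` and
  `μ′_{B′} ∧ v = Σ_B (−1)ⁿκ(−1)^{|B|}q̃_{n−|B′|+|B|}·g_B + (b r)·f_{B′}` with `g_B = μ_B·m_Q`, `f_{B′} = m_P·μ′_{B′}`, `q̃_i = (−1)^i q_i`,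
  `r = (−1)^{C(n,2)}`, `κ = (−1)^{C(n+1,2)}` (from `wordP_mul_w` / `wordQ_mul_w` and the vanishing `μ_B ∧ E_{Dm} = 0`);
* (part 2, `Mod4SiteMiddleModelU.lean`) the independence of the tags and **`finrank_span_words_mul_vW`**:
  `dim span{μ_B ∧ v, μ′_{B′} ∧ v} + dim ker(Mod4.middleM n q̃ − (ab)·1) = 2ⁿ + 2ⁿ` (`Mod4SiteUBlock.finrank_span_Ublock` in the model).
All statements and proofs: w3-mod4-1 g5 (2026-08-23).  Namespace `Summit.Ventures.HSemireg.Mod4Site`.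
-/

namespace Summit.Ventures.HSemireg.Mod4Site

open ExteriorAlgebra Summit.Ventures.HSemireg.Wedge Summit.Ventures.HSemireg.Wedge.Hankel Summit.Ventures.HSemireg.Wedge.Weil
open Summit.Ventures.HSemireg.Wedge.WeilPurity (r r_ne_zero pp B_Dm_eq B_Gm_eq)
open Summit.Ventures.HSemireg.Mod4

variable {K : Type*} [Field K] {N n : ℕ}

/-! ### §0 Pair products are central for products of generators -/

section PairComm

variable {R : Type*} [CommRing R] {M : Type*} [AddCommGroup M] [Module R M]

/-- a generator commutes with a product of pairs `Π (ι x_k · ι y_k)` (each pair is even). -/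
lemma ι_mul_pairProd_comm (v : M) {m : ℕ} (x y : Fin m → M) :
    ι R v * (List.ofFn fun k => ι R (x k) * ι R (y k)).prod = (List.ofFn fun k => ι R (x k) * ι R (y k)).prod * ι R v := by
  induction m with
  | zero => simp
  | succ m ih =>
    have key : ι R v * (ι R (x 0) * ι R (y 0)) = (ι R (x 0) * ι R (y 0)) * ι R v := by
      rw [← mul_assoc, ι_mul_ι_eq_neg v (x 0), neg_mul, mul_assoc, ι_mul_ι_eq_neg v (y 0), mul_neg, neg_neg, ← mul_assoc]
    rw [List.ofFn_succ, List.prod_cons, ← mul_assoc, key, mul_assoc, ih (fun k => x k.succ) (fun k => y k.succ), ← mul_assoc]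

/-- a product of generators commutes with a product of pairs. -/
lemma prod_ι_mul_pairProd_comm {m' m : ℕ} (l : Fin m' → M) (x y : Fin m → M) :
    (List.ofFn fun j => ι R (l j)).prod * (List.ofFn fun k => ι R (x k) * ι R (y k)).prod =
      (List.ofFn fun k => ι R (x k) * ι R (y k)).prod * (List.ofFn fun j => ι R (l j)).prod := by
  induction m' with
  | zero => simp
  | succ m' ih =>
    rw [List.ofFn_succ, List.prod_cons, mul_assoc, ih (fun j => l j.succ), ← mul_assoc, ι_mul_pairProd_comm, mul_assoc]

end PairComm

/-! ### §1 Ordered products of distinct generators are unit multiples of basis monomials -/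

/-- a generator is `ι` of its basis vector. -/
lemma ι_b_eq_gx (i : In N) : ι K (b K (In N) i) = gx K i := (gx_eq_ι K i).symm

/-- **an ordered product of generators at pairwise distinct indices is a non-zero multiple of the basis monomial of the index set.** -/
theorem prod_ι_b_eq_smul_B {m : ℕ} (l : Fin m → In N) (hl : Function.Injective l) :
    ∃ c : K, c ≠ 0 ∧ (List.ofFn fun k => ι K (b K (In N) (l k))).prod = c • B K (In N) (Finset.univ.image l) := by
  classical
  induction m with
  | zero =>
    refine ⟨1, one_ne_zero, ?_⟩
    rw [List.ofFn_zero, List.prod_nil, Finset.univ_eq_empty, Finset.image_empty, B_empty, one_smul]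
  | succ m ih =>
    obtain ⟨c, hc, h⟩ := ih (fun k => l k.succ) (fun i j hij => Fin.succ_injective _ (hl hij))
    have hnot : l 0 ∉ Finset.univ.image (fun k : Fin m => l k.succ) := by
      intro hmem
      obtain ⟨k, -, hk⟩ := Finset.mem_image.mp hmem
      exact Fin.succ_ne_zero k (hl hk)
    have hu : u K ({l 0} : Finset (In N)) (Finset.univ.image fun k : Fin m => l k.succ) ≠ 0 :=
      (u_ne_zero_iff K).mpr (Finset.disjoint_singleton_left.mpr hnot)
    refine ⟨c * u K ({l 0} : Finset (In N)) (Finset.univ.image fun k : Fin m => l k.succ), mul_ne_zero hc hu, ?_⟩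
    have himg : Finset.univ.image l = {l 0} ∪ Finset.univ.image (fun k : Fin m => l k.succ) := by
      ext i
      simp only [Finset.mem_image, Finset.mem_univ, true_and, Finset.mem_union, Finset.mem_singleton]
      constructor
      · rintro ⟨k, rfl⟩
        rcases Fin.eq_zero_or_eq_succ k with h0 | ⟨j, rfl⟩
        · left; rw [h0]
        · right; exact ⟨j, rfl⟩
      · rintro (h0 | ⟨j, rfl⟩)
        · exact ⟨0, h0.symm⟩
        · exact ⟨j.succ, rfl⟩
    rw [List.ofFn_succ, List.prod_cons, h, mul_smul_comm, ι_b_eq_gx, gx, B_mul_B, smul_smul, himg]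

/-! ### §2 th-7's block monomials are the pair products (up to `(−1)^{C(n,2)}`) -/

/-- th-7's pair product `pp s m = Π_{c=s}^{s+m−1}(x_c ∧ y_c)` in `List.ofFn` form. -/
lemma pp_eq_prod_ofFn (s m : ℕ) (h : s + m ≤ n + n) :
    pp K n s m = (List.ofFn fun k : Fin m => ι K (b K (In (n + n)) (xJ (n + n) ⟨s + k, by omega⟩)) *
      ι K (b K (In (n + n)) (yJ (n + n) ⟨s + k, by omega⟩))).prod := by
  induction m with
  | zero => rw [pp, List.ofFn_zero, List.prod_nil]
  | succ m ih =>
    rw [pp, ih (by omega), List.ofFn_succ', List.prod_concat]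
    congr 1
    have hsm : s + m < n + n := by omega
    rw [X, Y, dif_pos hsm, dif_pos hsm, ← ι_b_eq_gx, ← ι_b_eq_gx, xI_eq_xJ, yI_eq_yJ]
    rfl

/-- `E_{Dm} = r · m_P`, `m_P = Π_{k<n} (x_k ∧ y_k)` (th-7's `B_Dm_eq`). -/
theorem B_Dm_eq_smul_pairProd (n : ℕ) :
    B K (In (n + n)) (Dm (n + n) n) = r K n • (List.ofFn fun k : Fin n =>
      ι K (b K (In (n + n)) (xJ (n + n) (Fin.castAdd n k))) * ι K (b K (In (n + n)) (yJ (n + n) (Fin.castAdd n k)))).prod := by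
  rw [B_Dm_eq, pp_eq_prod_ofFn 0 n (by omega)]
  congr 1
  refine congrArg _ (congrArg _ (funext fun k => ?_))
  have : (⟨0 + (k : ℕ), by omega⟩ : Fin (n + n)) = Fin.castAdd n k := Fin.ext (by simp)
  rw [this]

/-- `E_{Gm} = r · m_Q`, `m_Q = Π_{k<n} (x′_k ∧ y′_k)` (th-7's `B_Gm_eq`). -/
theorem B_Gm_eq_smul_pairProd (n : ℕ) :
    B K (In (n + n)) (Gm (n + n) n) = r K n • (List.ofFn fun k : Fin n =>
      ι K (b K (In (n + n)) (xJ (n + n) (Fin.natAdd n k))) * ι K (b K (In (n + n)) (yJ (n + n) (Fin.natAdd n k)))).prod := by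
  rw [B_Gm_eq, pp_eq_prod_ofFn n n (by omega)]
  rfl

/-! ### §3 The rows `μ_B ∧ v`, `μ′_{B′} ∧ v` in the model -/

section Rows

variable (n)

/-- the letter index of the block-`D` selection word `μ_B`: `y` at the pairs of `B`, `x` elsewhere. -/
lemma letterD_injective (S : Finset (Fin n)) :
    Function.Injective (fun k : Fin n => if k ∈ S then yJ (n + n) (Fin.castAdd n k) else xJ (n + n) (Fin.castAdd n k)) := by
  intro k k' h
  have := congrArg pr h
  simp only [apply_ite pr, pr_xJ, pr_yJ, ite_self] at this
  exact Fin.castAdd_injective _ _ this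

/-- the letter index of the block-`G` selection word `μ′_{B′}`. -/
lemma letterG_injective (S : Finset (Fin n)) :
    Function.Injective (fun k : Fin n => if k ∈ S then yJ (n + n) (Fin.natAdd n k) else xJ (n + n) (Fin.natAdd n k)) := by
  intro k k' h
  have := congrArg pr h
  simp only [apply_ite pr, pr_xJ, pr_yJ, ite_self] at this
  exact Fin.natAdd_injective _ _ this

variable {n}

/-- `μ_B` is a non-zero multiple of the basis monomial of its letter set `t_B ⊆ Dm`. -/
lemma wordP_eq_smul_B (S : Finset (Fin n)) : ∃ c : K, c ≠ 0 ∧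
    (List.ofFn fun k : Fin n => ι K (if k ∈ S then b K (In (n + n)) (yJ (n + n) (Fin.castAdd n k))
        else b K (In (n + n)) (xJ (n + n) (Fin.castAdd n k)))).prod =
      c • B K (In (n + n)) (Finset.univ.image fun k : Fin n =>
        if k ∈ S then yJ (n + n) (Fin.castAdd n k) else xJ (n + n) (Fin.castAdd n k)) := by
  obtain ⟨c, hc, h⟩ := prod_ι_b_eq_smul_B (K := K) _ (letterD_injective n S)
  refine ⟨c, hc, ?_⟩
  rw [← h]
  refine congrArg _ (congrArg _ (funext fun k => ?_))
  rw [apply_ite (b K (In (n + n)))]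

/-- `μ′_{B′}` is a non-zero multiple of the basis monomial of its letter set `t′_{B′} ⊆ Gm`. -/
lemma wordQ_eq_smul_B (S : Finset (Fin n)) : ∃ c : K, c ≠ 0 ∧
    (List.ofFn fun k : Fin n => ι K (if k ∈ S then b K (In (n + n)) (yJ (n + n) (Fin.natAdd n k))
        else b K (In (n + n)) (xJ (n + n) (Fin.natAdd n k)))).prod =
      c • B K (In (n + n)) (Finset.univ.image fun k : Fin n =>
        if k ∈ S then yJ (n + n) (Fin.natAdd n k) else xJ (n + n) (Fin.natAdd n k)) := by
  obtain ⟨c, hc, h⟩ := prod_ι_b_eq_smul_B (K := K) _ (letterG_injective n S)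
  refine ⟨c, hc, ?_⟩
  rw [← h]
  refine congrArg _ (congrArg _ (funext fun k => ?_))
  rw [apply_ite (b K (In (n + n)))]

/-- the letter set of `μ_B` lies in `Dm`. -/
lemma letterD_subset_Dm (S : Finset (Fin n)) :
    (Finset.univ.image fun k : Fin n => if k ∈ S then yJ (n + n) (Fin.castAdd n k) else xJ (n + n) (Fin.castAdd n k)) ⊆
      Dm (n + n) n := by
  intro i hi
  obtain ⟨k, -, rfl⟩ := Finset.mem_image.mp hi
  rw [mem_Dm_iff]
  simp only [apply_ite pr, pr_xJ, pr_yJ, ite_self, Fin.val_castAdd]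
  exact k.is_lt

/-- the letter set of `μ′_{B′}` lies in `Gm`. -/
lemma letterG_subset_Gm (S : Finset (Fin n)) :
    (Finset.univ.image fun k : Fin n => if k ∈ S then yJ (n + n) (Fin.natAdd n k) else xJ (n + n) (Fin.natAdd n k)) ⊆
      Gm (n + n) n := by
  intro i hi
  obtain ⟨k, -, rfl⟩ := Finset.mem_image.mp hi
  rw [mem_Gm_iff]
  simp only [apply_ite pr, pr_xJ, pr_yJ, ite_self, Fin.val_natAdd]
  exact Nat.le_add_right n k

/-- `μ_B ∧ E_{Dm} = 0` (`n ≥ 1`: the word has a letter in `Dm`). -/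
lemma wordP_mul_B_Dm (hn : 1 ≤ n) (S : Finset (Fin n)) :
    (List.ofFn fun k : Fin n => ι K (if k ∈ S then b K (In (n + n)) (yJ (n + n) (Fin.castAdd n k))
        else b K (In (n + n)) (xJ (n + n) (Fin.castAdd n k)))).prod * B K (In (n + n)) (Dm (n + n) n) = 0 := by
  obtain ⟨c, -, h⟩ := wordP_eq_smul_B (K := K) S
  have hnd : ¬ Disjoint (Finset.univ.image fun k : Fin n =>
      if k ∈ S then yJ (n + n) (Fin.castAdd n k) else xJ (n + n) (Fin.castAdd n k)) (Dm (n + n) n) := by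
    intro hd
    have hmem : (if (⟨0, hn⟩ : Fin n) ∈ S then yJ (n + n) (Fin.castAdd n ⟨0, hn⟩) else xJ (n + n) (Fin.castAdd n ⟨0, hn⟩)) ∈
        Finset.univ.image (fun k : Fin n => if k ∈ S then yJ (n + n) (Fin.castAdd n k) else xJ (n + n) (Fin.castAdd n k)) :=
      Finset.mem_image.mpr ⟨⟨0, hn⟩, Finset.mem_univ _, rfl⟩
    exact Finset.disjoint_left.mp hd hmem (letterD_subset_Dm S hmem)
  rw [h, smul_mul_assoc, B_mul_B, u_eq_zero K hnd, zero_smul, smul_zero]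

/-- `μ′_{B′} ∧ E_{Gm} = 0` (`n ≥ 1`). -/
lemma wordQ_mul_B_Gm (hn : 1 ≤ n) (S : Finset (Fin n)) :
    (List.ofFn fun k : Fin n => ι K (if k ∈ S then b K (In (n + n)) (yJ (n + n) (Fin.natAdd n k))
        else b K (In (n + n)) (xJ (n + n) (Fin.natAdd n k)))).prod * B K (In (n + n)) (Gm (n + n) n) = 0 := by
  obtain ⟨c, -, h⟩ := wordQ_eq_smul_B (K := K) S
  have hnd : ¬ Disjoint (Finset.univ.image fun k : Fin n =>
      if k ∈ S then yJ (n + n) (Fin.natAdd n k) else xJ (n + n) (Fin.natAdd n k)) (Gm (n + n) n) := by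
    intro hd
    have hmem : (if (⟨0, hn⟩ : Fin n) ∈ S then yJ (n + n) (Fin.natAdd n ⟨0, hn⟩) else xJ (n + n) (Fin.natAdd n ⟨0, hn⟩)) ∈
        Finset.univ.image (fun k : Fin n => if k ∈ S then yJ (n + n) (Fin.natAdd n k) else xJ (n + n) (Fin.natAdd n k)) :=
      Finset.mem_image.mpr ⟨⟨0, hn⟩, Finset.mem_univ _, rfl⟩
    exact Finset.disjoint_left.mp hd hmem (letterG_subset_Gm S hmem)
  rw [h, smul_mul_assoc, B_mul_B, u_eq_zero K hnd, zero_smul, smul_zero]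

/-- the sign bridge between the model rows and the `q̃`-rows of `finrank_span_Ublock`:
`κ·(−1)^{m′}·(−1)^{n−m+m′} = (−1)^{C(n,2)+m}` for `m ≤ n` (`κ = (−1)^{C(n+1,2)}`). -/
lemma sign_bridge {m : ℕ} (hm : m ≤ n) (m' : ℕ) :
    ((-1 : K) ^ (n + 1).choose 2) * (-1 : K) ^ m' * (-1 : K) ^ (n - m + m') = (-1 : K) ^ (n.choose 2 + m) := by
  have e2 : (n + 1).choose 2 = n + n.choose 2 := by
    rw [show 2 = 1 + 1 from rfl, Nat.choose_succ_succ, Nat.choose_one_right]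
  rw [← pow_add, ← pow_add, neg_one_pow_eq_pow_mod_two, neg_one_pow_eq_pow_mod_two (n.choose 2 + m), e2]
  congr 1
  omega

/-- the mirror bridge: `(−1)ⁿ·κ·(−1)^{m}·(−1)^{n−m′+m} = (−1)^{n+(C(n,2)+m′)}` for `m′ ≤ n`. -/
lemma sign_bridge' {m' : ℕ} (hm : m' ≤ n) (m : ℕ) :
    (-1 : K) ^ n * ((-1 : K) ^ (n + 1).choose 2) * (-1 : K) ^ m * (-1 : K) ^ (n - m' + m) =
      (-1 : K) ^ (n + (n.choose 2 + m')) := by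
  have e2 : (n + 1).choose 2 = n + n.choose 2 := by
    rw [show 2 = 1 + 1 from rfl, Nat.choose_succ_succ, Nat.choose_one_right]
  rw [← pow_add, ← pow_add, ← pow_add, neg_one_pow_eq_pow_mod_two, neg_one_pow_eq_pow_mod_two (n + (n.choose 2 + m')), e2]
  congr 1
  omega

/-- **ROW of `μ_B ∧ v` in the model**, in the form of `Mod4SiteUBlock.finrank_span_Ublock` (`q̃_i = (−1)^i q_i`, `α = a·r`):
`μ_B ∧ v = (a r)·(μ_B·m_Q) + Σ_{B′} κ(−1)^{|B′|}q̃_{n−|B|+|B′|}·(m_P·μ′_{B′})`. -/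
theorem wordP_mul_vW (hn : 1 ≤ n) (S : Finset (Fin n)) (q : ℕ → K) (a b' : K) :
    (List.ofFn fun k : Fin n => ι K (if k ∈ S then b K (In (n + n)) (yJ (n + n) (Fin.castAdd n k))
        else b K (In (n + n)) (xJ (n + n) (Fin.castAdd n k)))).prod * vW K (n + n) n q a b' =
      (a * r K n) • ((List.ofFn fun k : Fin n => ι K (if k ∈ S then b K (In (n + n)) (yJ (n + n) (Fin.castAdd n k))
          else b K (In (n + n)) (xJ (n + n) (Fin.castAdd n k)))).prod *
        (List.ofFn fun k : Fin n => ι K (b K (In (n + n)) (xJ (n + n) (Fin.natAdd n k))) *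
          ι K (b K (In (n + n)) (yJ (n + n) (Fin.natAdd n k)))).prod) +
      ∑ S' : Finset (Fin n), (((-1 : K) ^ (n + 1).choose 2) * (-1 : K) ^ S'.card *
          ((-1 : K) ^ (n - S.card + S'.card) * q (n - S.card + S'.card))) •
        ((List.ofFn fun k : Fin n => ι K (b K (In (n + n)) (xJ (n + n) (Fin.castAdd n k))) *
            ι K (b K (In (n + n)) (yJ (n + n) (Fin.castAdd n k)))).prod *
         (List.ofFn fun k : Fin n => ι K (if k ∈ S' then b K (In (n + n)) (yJ (n + n) (Fin.natAdd n k))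
            else b K (In (n + n)) (xJ (n + n) (Fin.natAdd n k)))).prod) := by
  have hBn : S.card ≤ n := by simpa using Finset.card_le_univ S
  rw [vW_mul_expand, wordP_mul_B_Dm hn, smul_zero, add_zero, B_Gm_eq_smul_pairProd, mul_smul_comm, smul_smul,
    wordP_mul_w, add_comm (((-1 : K) ^ (n.choose 2 + S.card)) • _), Finset.smul_sum]
  congr 1
  refine Finset.sum_congr rfl fun S' _ => ?_
  rw [smul_smul, ← sign_bridge (K := K) hBn S'.card]
  congr 1
  ring

/-- **ROW of `μ′_{B′} ∧ v` in the model** (`β = b·r`):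
`μ′_{B′} ∧ v = Σ_B (−1)ⁿκ(−1)^{|B|}q̃_{n−|B′|+|B|}·(μ_B·m_Q) + (b r)·(m_P·μ′_{B′})`. -/
theorem wordQ_mul_vW (hn : 1 ≤ n) (S' : Finset (Fin n)) (q : ℕ → K) (a b' : K) :
    (List.ofFn fun k : Fin n => ι K (if k ∈ S' then b K (In (n + n)) (yJ (n + n) (Fin.natAdd n k))
        else b K (In (n + n)) (xJ (n + n) (Fin.natAdd n k)))).prod * vW K (n + n) n q a b' =
      (∑ S : Finset (Fin n), ((-1 : K) ^ n * ((-1 : K) ^ (n + 1).choose 2) * (-1 : K) ^ S.card *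
          ((-1 : K) ^ (n - S'.card + S.card) * q (n - S'.card + S.card))) •
        ((List.ofFn fun k : Fin n => ι K (if k ∈ S then b K (In (n + n)) (yJ (n + n) (Fin.castAdd n k))
            else b K (In (n + n)) (xJ (n + n) (Fin.castAdd n k)))).prod *
         (List.ofFn fun k : Fin n => ι K (b K (In (n + n)) (xJ (n + n) (Fin.natAdd n k))) *
            ι K (b K (In (n + n)) (yJ (n + n) (Fin.natAdd n k)))).prod)) +
      (b' * r K n) • ((List.ofFn fun k : Fin n => ι K (b K (In (n + n)) (xJ (n + n) (Fin.castAdd n k))) *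
            ι K (b K (In (n + n)) (yJ (n + n) (Fin.castAdd n k)))).prod *
        (List.ofFn fun k : Fin n => ι K (if k ∈ S' then b K (In (n + n)) (yJ (n + n) (Fin.natAdd n k))
            else b K (In (n + n)) (xJ (n + n) (Fin.natAdd n k)))).prod) := by
  have hBn : S'.card ≤ n := by simpa using Finset.card_le_univ S'
  rw [vW_mul_expand, wordQ_mul_B_Gm hn, smul_zero, add_zero, B_Dm_eq_smul_pairProd, mul_smul_comm, smul_smul, wordQ_mul_w,
    Finset.smul_sum]
  congr 1
  · refine Finset.sum_congr rfl fun S _ => ?_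
    rw [smul_smul, ← sign_bridge' (K := K) hBn S.card]
    congr 1
    ring
  · -- `μ′ · m_P = m_P · μ′` (`m_P` is a product of even pairs)
    congr 1
    rw [prod_ι_mul_pairProd_comm]

end Rows

end Summit.Ventures.HSemireg.Mod4Site
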